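import Mathlib.RingTheory.DedekindDomain.IntegralClosure
import Mathlib.RingTheory.DedekindDomain.AdicValuation
import Mathlib.RingTheory.Valuation.ValuationSubring
import Mathlib.Algebra.Algebra.ZMod
import Mathlib.Algebra.CharP.Lemmas
import Mathlib.FieldTheory.IntermediateField.Adjoin.Algebra
import Mathlib.FieldTheory.IntermediateField.Algebraic
import Literature.AnabelianGeometry.AbsoluteAnabelian.DVRValuationLemmas
import HarnessLib

/-!
# Infinitely divisible units of finite extensions of the fraction field of a DVR are torsion

Let `A` be a discrete valuation ring whose maximal ideal contains a prime number `p` and whose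
residue field is algebraic over `𝔽_p` (hypothesis `hres`: every `a ∈ A` satisfies a monic integer
polynomial modulo the maximal ideal — e.g. `A = ℤ_p`, or `A = W(𝔽̄_p)` by Teichmüller
representatives), `F = Frac A`, and `M/F` a finite separable extension.  Then every unit `x ∈ M^×`
that is an `N`-th power for all `N ≥ 1` has finite order
(`isOfFinOrder_of_forall_exists_pow_eq_of_finiteDimensional`).

Proof.  Let `C` be the integral closure of `A` in `M` (a Dedekind domain, Krull–Akizuki), `Q` a
prime of `C` above the maximal ideal of `A`, `v` the `Q`-adic valuation (`ℤ`-valued).  (i) `v(x)` is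
divisible by every `N`, so `v(x) = 0`.  (ii) `1, x, …, xⁿ` (`n = [M:F]`) are `F`-linearly dependent;
normalising the coefficient of largest valuation to `1` puts all coefficients in `A`, and reducing
modulo `Q` shows that the residue `x̄` is algebraic over the residue field of `A`, hence over `𝔽_p`,
hence of finite order `m`: `x^m ∈ 1 + 𝔪_v`.  (iii) `z = x^m` is still infinitely divisible; if
`z = y^{p^k}` then `ȳ = 1` (Frobenius is injective on the residue field) and
`v(y^p - 1) ≤ v(y - 1) + max(v(p), v(y - 1)) ≤ v(y - 1) - 1` (additively), so `v(z - 1) ≤ -k - 1` for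
all `k`, forcing `z = 1`.

This is the field-theoretic input of the class-field-theory-free proof of [Tpcs] Lemma 4.14
(S. Mochizuki, *Topics surrounding the anabelian geometry of hyperbolic curves* (2003), p. 48:
`Γ_K` is center-free for generalized sub-`p`-adic `K`; cell decl `Tpcs.Lem_4_14`).  Proof-only, no
definitions, Mathlib only. [cite: MochizukiTopics2003, Lem 4.14 p.48]
-/

noncomputable section

open scoped Classical
open Polynomial IsLocalRing

namespace Literature.AnabelianGeometry.AbsoluteAnabelian

universe u v w

section DVR

/-- **Infinitely divisible units of a finite separable extension `M` of `Frac A`, `A` a DVR with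
`p ∈ 𝔪_A` and residue field algebraic over `𝔽_p`, have finite order.**
[cite: MochizukiTopics2003, Lem 4.14 p.48] -/
theorem isOfFinOrder_of_forall_exists_pow_eq_of_finiteDimensional
    (A : Type u) [CommRing A] [IsDomain A] [IsDiscreteValuationRing A]
    (F : Type v) [Field F] [Algebra A F] [IsFractionRing A F]
    {M : Type w} [Field M] [Algebra F M] [FiniteDimensional F M] [Algebra A M] [IsScalarTower A F M]
    [Algebra.IsSeparable F M] {p : ℕ} [Fact p.Prime]
    (hp : (p : A) ∈ maximalIdeal A)
    (hres : ∀ a : A, ∃ f : ℤ[X], f.Monic ∧ aeval a f ∈ maximalIdeal A)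
    (x : Mˣ) (hx : ∀ N : ℕ, 0 < N → ∃ y : Mˣ, y ^ N = x) : IsOfFinOrder x := by
  have hprime : (p : ℕ).Prime := Fact.out
  -- ### Step 0: the valuation
  obtain ⟨ϖ, hϖ⟩ := IsDiscreteValuationRing.exists_irreducible A
  have hinjAM : Function.Injective (algebraMap A M) := by
    rw [IsScalarTower.algebraMap_eq A F M]
    exact (algebraMap F M).injective.comp (IsFractionRing.injective A F)
  set Cl : Subalgebra A M := integralClosure A M with hCl
  haveI : IsDedekindDomain Cl := integralClosure.isDedekindDomain A F M
  haveI : IsFractionRing Cl M := integralClosure.isFractionRing_of_finite_extension F M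
  set 𝔭 : Ideal A := maximalIdeal A with h𝔭
  have hcomap : (⊥ : Ideal Cl).comap (algebraMap A Cl) ≤ 𝔭 := by
    intro r hr
    rw [Ideal.mem_comap, Ideal.mem_bot] at hr
    have : algebraMap A M r = 0 := by
      have := congrArg (fun c : Cl => (c : M)) hr
      simpa using this
    rw [map_eq_zero_iff _ hinjAM] at this
    rw [this]; exact zero_mem _
  obtain ⟨Q, -, hQprime, hQ⟩ := Ideal.exists_ideal_over_prime_of_isIntegral 𝔭 (⊥ : Ideal Cl) hcomap
  have hmemC : ∀ a : A, algebraMap A M a ∈ Cl := fun a => by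
    rw [hCl, mem_integralClosure_iff]; exact isIntegral_algebraMap
  have halgC : ∀ a : A, algebraMap A Cl a = ⟨algebraMap A M a, hmemC a⟩ := fun a =>
    Subtype.ext (IsScalarTower.algebraMap_apply A Cl M a).symm.symm
  have hQmem : ∀ a : A, a ∈ 𝔭 → (⟨algebraMap A M a, hmemC a⟩ : Cl) ∈ Q := by
    intro a ha
    rw [← halgC, ← Ideal.mem_comap, hQ]; exact ha
  have hϖ𝔭 : ϖ ∈ 𝔭 := (IsDiscreteValuationRing.irreducible_iff_uniformizer ϖ).mp hϖ ▸
    Ideal.mem_span_singleton_self ϖ |> fun h => by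
      rw [h𝔭, (IsDiscreteValuationRing.irreducible_iff_uniformizer ϖ).mp hϖ]
      exact Ideal.mem_span_singleton_self ϖ
  have hQne : Q ≠ ⊥ := by
    intro h
    have := hQmem ϖ hϖ𝔭
    rw [h, Ideal.mem_bot] at this
    have h0 : algebraMap A M ϖ = 0 := congrArg (fun c : Cl => (c : M)) this
    exact hϖ.ne_zero ((map_eq_zero_iff _ hinjAM).mp h0)
  let Qh : IsDedekindDomain.HeightOneSpectrum Cl := ⟨Q, hQprime, hQne⟩
  set v : Valuation M (WithZero (Multiplicative ℤ)) := Qh.valuation M with hv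
  -- basic values
  have hvC : ∀ c : Cl, v (c : M) ≤ 1 := fun c => Qh.valuation_le_one c
  have hvA : ∀ a : A, v (algebraMap A M a) ≤ 1 := fun a => hvC ⟨_, hmemC a⟩
  have hv𝔭 : ∀ a : A, a ∈ 𝔭 → v (algebraMap A M a) < 1 := fun a ha =>
    (IsDedekindDomain.HeightOneSpectrum.valuation_lt_one_iff_mem Qh ⟨_, hmemC a⟩).2 (hQmem a ha)
  have hvϖ : v (algebraMap A M ϖ) < 1 := hv𝔭 ϖ hϖ𝔭
  have hvp : v (p : M) < 1 := by
    have : (p : M) = algebraMap A M (p : A) := by simp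
    rw [this]; exact hv𝔭 _ hp
  -- ### Step 1: `v x = 1` (and `v y = 1` whenever `y ^ N = x`)
  have hx0 : (x : M) ≠ 0 := x.ne_zero
  have hvx : v (x : M) = 1 := by
    refine withZero_eq_one_of_forall_pow ((Valuation.ne_zero_iff v).mpr hx0) fun N hN => ?_
    obtain ⟨y, hy⟩ := hx N hN
    exact ⟨v (y : M), by rw [← map_pow, ← Units.val_pow_eq_pow_val, hy]⟩
  have hvroot : ∀ (N : ℕ) (y : Mˣ), 0 < N → y ^ N = x → v (y : M) = 1 := by
    intro N y hN hy
    have hy' : v (y : M) ^ N = 1 := by rw [← map_pow, ← Units.val_pow_eq_pow_val, hy, hvx]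
    exact withZero_eq_one_of_pow_eq_one ((Valuation.ne_zero_iff v).mpr y.ne_zero) hN.ne' hy'
  -- ### Step 2: elements of `F` of valuation `≤ 1` come from `A`
  have hFA : ∀ z : F, v (algebraMap F M z) ≤ 1 → ∃ a : A, algebraMap A F a = z :=
    fun z hz => exists_eq_algebraMap_of_valuation_le_one v hvA hϖ hvϖ z hz
  -- ### Step 3: a linear relation `∑ aᵢ x^i = 0` with `aᵢ ∈ A`, some `a_j = 1`
  set n : ℕ := Module.finrank F M with hn
  have hdep : ¬ LinearIndependent F (fun i : Fin (n + 1) => (x : M) ^ (i : ℕ)) := by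
    intro hli
    have := hli.fintype_card_le_finrank
    rw [Fintype.card_fin] at this
    omega
  obtain ⟨g, hg, i₀, hi₀⟩ := Fintype.not_linearIndependent_iff.mp hdep
  -- the index of maximal valuation among the nonzero coefficients
  obtain ⟨j, hjS, hjmax⟩ := Finset.exists_max_image (Finset.univ.filter fun i => g i ≠ 0)
    (fun i => v (algebraMap F M (g i))) ⟨i₀, by simpa using hi₀⟩
  have hgj : g j ≠ 0 := by simpa using hjS
  have hgjM : algebraMap F M (g j) ≠ 0 := (_root_.map_ne_zero _).mpr hgj
  set d : Fin (n + 1) → F := fun i => g i / g j with hd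
  have hdj : d j = 1 := div_self hgj
  have hdle : ∀ i, v (algebraMap F M (d i)) ≤ 1 := by
    intro i
    by_cases hgi : g i = 0
    · simp [hd, hgi]
    · have hle := hjmax i (by simpa using hgi)
      have hvj0 : 0 < v (algebraMap F M (g j)) :=
        lt_of_le_of_ne zero_le ((Valuation.ne_zero_iff v).mpr hgjM).symm
      show v (algebraMap F M (g i / g j)) ≤ 1
      rw [map_div₀, map_div₀, div_le_one₀ hvj0]
      exact hle
  have hdsum : ∑ i, algebraMap F M (d i) * (x : M) ^ (i : ℕ) = 0 := by
    have : ∑ i, algebraMap F M (d i) * (x : M) ^ (i : ℕ) =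
        (algebraMap F M (g j))⁻¹ * ∑ i, g i • (x : M) ^ (i : ℕ) := by
      rw [Finset.mul_sum]
      refine Finset.sum_congr rfl fun i _ => ?_
      rw [hd, Algebra.smul_def, map_div₀, div_eq_mul_inv]
      ring
    rw [this, hg, mul_zero]
  choose a ha using fun i => hFA (d i) (hdle i)
  have haj : a j = 1 := by
    apply IsFractionRing.injective A F
    rw [ha, hdj, map_one]
  have hasum : ∑ i, algebraMap A M (a i) * (x : M) ^ (i : ℕ) = 0 := by
    rw [← hdsum]
    refine Finset.sum_congr rfl fun i _ => ?_
    rw [IsScalarTower.algebraMap_apply A F M, ha]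
  -- ### Step 4: the residue field
  set O : ValuationSubring M := v.valuationSubring with hO
  have hmemO : ∀ {z : M}, v z ≤ 1 → z ∈ O := fun h => (Valuation.mem_valuationSubring_iff _ _).mpr h
  have hequiv := Valuation.isEquiv_valuation_valuationSubring v
  have hmaxO : ∀ z : O, z ∈ maximalIdeal O ↔ v (z : M) < 1 := by
    intro z
    rw [ValuationSubring.valuation_lt_one_iff, ← hequiv.lt_one_iff_lt_one]
  set κ := ResidueField O with hκ
  set ψ : A →+* O := (algebraMap A M).codRestrict O.toSubring (fun a => hmemO (hvA a)) with hψ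
  set ρ : A →+* κ := (residue O).comp ψ with hρ
  have hρ𝔭 : ∀ a : A, a ∈ 𝔭 → ρ a = 0 := by
    intro a ha
    rw [hρ, RingHom.comp_apply, residue_eq_zero_iff, hmaxO]
    exact hv𝔭 a ha
  have hpκ : (p : κ) = 0 := by
    have : (p : κ) = ρ (p : A) := by simp
    rw [this]; exact hρ𝔭 _ hp
  haveI hcharκ : CharP κ p := (CharP.charP_iff_prime_eq_zero hprime).mpr hpκ
  letI : Algebra (ZMod p) κ := ZMod.algebra κ p
  -- residues of `A` are algebraic over `𝔽_p`
  have hρint : ∀ a : A, IsIntegral (ZMod p) (ρ a) := by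
    intro a
    obtain ⟨f, hfmonic, hf𝔭⟩ := hres a
    have h0 : aeval (ρ a) f = 0 := by
      rw [show ρ a = ρ.toIntAlgHom a from rfl, Polynomial.aeval_algHom_apply]
      change ρ (aeval a f) = 0
      exact hρ𝔭 _ hf𝔭
    refine ⟨f.map (Int.castRingHom (ZMod p)), hfmonic.map _, ?_⟩
    rw [eval₂_map, show (algebraMap (ZMod p) κ).comp (Int.castRingHom (ZMod p)) = algebraMap ℤ κ from
      Subsingleton.elim _ _]
    exact h0
  -- the unit `x` in `O`, its residue `x̄ ≠ 0`
  set xO : O := ⟨x, hmemO hvx.le⟩ with hxO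
  have hxOunit : IsUnit xO := by
    rw [ValuationSubring.valuation_eq_one_iff, ← hequiv.eq_one_iff_eq_one]; exact hvx
  set xb : κ := residue O xO with hxb
  have hxb0 : xb ≠ 0 := by
    rw [hxb, Ne, residue_eq_zero_iff]
    exact fun h => (hmaxO xO).mp h |>.ne hvx
  -- the relation in `κ`
  have hrelO : ∑ i, ψ (a i) * xO ^ (i : ℕ) = 0 := by
    apply Subtype.ext
    simp only [hψ, hxO]
    push_cast
    exact hasum
  have hrelκ : ∑ i, ρ (a i) * xb ^ (i : ℕ) = 0 := by
    have := congrArg (residue O) hrelO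
    simpa [hρ, hxb, map_sum, map_mul, map_pow] using this
  have hρj : ρ (a j) = 1 := by rw [haj, map_one]
  -- `x̄` is algebraic over `k₁ := 𝔽_p(ρ aᵢ)`, hence integral over `𝔽_p`
  set k₁ : IntermediateField (ZMod p) κ :=
    IntermediateField.adjoin (ZMod p) (Set.range fun i => ρ (a i)) with hk₁
  haveI : Algebra.IsAlgebraic (ZMod p) k₁ :=
    IntermediateField.isAlgebraic_adjoin fun y hy => by
      obtain ⟨i, rfl⟩ := hy
      exact hρint (a i)
  have hmemk₁ : ∀ i, ρ (a i) ∈ k₁ := fun i => IntermediateField.subset_adjoin _ _ ⟨i, rfl⟩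
  set P : k₁[X] := ∑ i : Fin (n + 1), C (⟨ρ (a i), hmemk₁ i⟩ : k₁) * X ^ (i : ℕ) with hP
  have hPj : P.coeff j = 1 := by
    rw [hP, finsetSum_coeff]
    rw [Finset.sum_eq_single j]
    · rw [coeff_C_mul_X_pow, if_pos rfl]
      exact Subtype.ext hρj
    · intro i _ hij
      rw [coeff_C_mul_X_pow, if_neg]
      exact fun h => hij (Fin.ext h).symm
    · intro h; exact absurd (Finset.mem_univ j) h
  have hP0 : P ≠ 0 := fun h => by
    have := hPj
    rw [h, coeff_zero] at this
    exact zero_ne_one this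
  have hPx : aeval xb P = 0 := by
    rw [hP, map_sum]
    simp only [map_mul, aeval_C, map_pow, aeval_X, IntermediateField.algebraMap_apply]
    exact hrelκ
  have hxbint : IsIntegral (ZMod p) xb := by
    have halg : IsAlgebraic k₁ xb := ⟨P, hP0, hPx⟩
    exact isIntegral_trans xb halg.isIntegral
  -- `x̄` has finite order `m`
  obtain ⟨m, hm, hxbm⟩ : ∃ m : ℕ, 0 < m ∧ xb ^ m = 1 :=
    exists_pow_eq_one_of_isIntegral_zmod hxb0 hxbint
  -- so `x ^ m ∈ 1 + 𝔪_v`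
  have hvxm1 : v ((x : M) ^ m - 1) < 1 := by
    have h1 : xO ^ m - 1 ∈ maximalIdeal O := by
      rw [← residue_eq_zero_iff, map_sub, map_pow, map_one, ← hxb, hxbm, sub_self]
    have := (hmaxO _).mp h1
    simpa [hxO] using this
  -- ### Step 5: `z := x ^ m` is infinitely divisible with `v (z - 1) < 1`, hence `z = 1`
  -- one Frobenius step (`DVRValuationLemmas`): `v (y^p - 1) ≤ v (y - 1) * max (v p) (v (y - 1))`
  have hnat : ∀ c : ℕ, v (c : M) ≤ 1 := fun c => by
    have : (c : M) = algebraMap A M (c : A) := by simp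
    rw [this]; exact hvA _
  have hstep : ∀ y : M, v (y - 1) < 1 →
      v (y ^ p - 1) ≤ v (y - 1) * max (v (p : M)) (v (y - 1)) :=
    fun y hy => valuation_pow_prime_sub_one_le v hprime hnat y hy
  -- integer exponents: `v w = ofAdd (e w)` for `w ≠ 0`
  have hexp : ∀ w : M, w ≠ 0 → ∃ e : ℤ, v w = ((Multiplicative.ofAdd e : Multiplicative ℤ) :
      WithZero (Multiplicative ℤ)) := by
    intro w hw
    obtain ⟨g, hg⟩ := WithZero.ne_zero_iff_exists.mp ((Valuation.ne_zero_iff v).mpr hw)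
    exact ⟨Multiplicative.toAdd g, by rw [ofAdd_toAdd, hg]⟩
  -- the iteration: if `z ≠ 1` is infinitely divisible, `v z = 1`-roots... contradiction
  set z : Mˣ := x ^ m with hzdef
  have hzdiv : ∀ N : ℕ, 0 < N → ∃ y : Mˣ, y ^ N = z := by
    intro N hN
    obtain ⟨y, hy⟩ := hx N hN
    exact ⟨y ^ m, by rw [← pow_mul, mul_comm, pow_mul, hy]⟩
  have hvz : v (z : M) = 1 := by rw [hzdef, Units.val_pow_eq_pow_val, map_pow, hvx, one_pow]
  -- residue `1`: every `p^k`-th root `y` of `z` has `v (y - 1) < 1`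
  have hroot1 : ∀ (k : ℕ) (y : Mˣ), y ^ p ^ k = z → v (y : M) = 1 ∧ v ((y : M) - 1) < 1 := by
    intro k y hy
    have hvy : v (y : M) = 1 := by
      have hy' : v (y : M) ^ p ^ k = 1 := by
        rw [← map_pow, ← Units.val_pow_eq_pow_val, hy, hvz]
      exact withZero_eq_one_of_pow_eq_one ((Valuation.ne_zero_iff v).mpr y.ne_zero)
        (pow_ne_zero k hprime.ne_zero) hy'
    refine ⟨hvy, ?_⟩
    -- in the residue field: `ȳ ^ p^k = z̄ = 1`, so `ȳ = 1`
    set yO : O := ⟨y, hmemO hvy.le⟩ with hyO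
    set zO : O := ⟨z, hmemO hvz.le⟩ with hzO
    have hzO1 : residue O zO = 1 := by
      have h1 : zO - 1 ∈ maximalIdeal O := by
        rw [hmaxO]
        simpa [hzO, hzdef] using hvxm1
      rw [← residue_eq_zero_iff, map_sub, map_one, sub_eq_zero] at h1
      exact h1
    have hyOp : residue O yO ^ p ^ k = 1 := by
      rw [← map_pow]
      have : yO ^ p ^ k = zO := Subtype.ext (by
        simp only [hyO, hzO]
        push_cast
        rw [← Units.val_pow_eq_pow_val, hy])
      rw [this, hzO1]
    have hyO1 : residue O yO = 1 := by
      have hfrob : (residue O yO - 1) ^ p ^ k = 0 := by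
        rw [sub_pow_char_pow, hyOp, one_pow, sub_self]
      exact sub_eq_zero.mp (pow_eq_zero_iff (pow_ne_zero k hprime.ne_zero) |>.mp hfrob)
    have h1 : yO - 1 ∈ maximalIdeal O := by
      rw [← residue_eq_zero_iff, map_sub, map_one, hyO1, sub_self]
    have := (hmaxO _).mp h1
    simpa [hyO] using this
  -- iterating `hstep`: `v (y^(p^i) - 1) ≤ ofAdd (e₀ - i)` in exponents
  by_contra hxfin
  have hz1 : (z : M) ≠ 1 := by
    intro h
    apply hxfin
    exact isOfFinOrder_iff_pow_eq_one.mpr ⟨m, hm, Units.ext (by simpa [hzdef] using h)⟩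
  have hz10 : (z : M) - 1 ≠ 0 := sub_ne_zero.mpr hz1
  obtain ⟨ez, hez⟩ := hexp _ hz10
  -- the key iteration lemma on exponents
  have hiter : ∀ (k : ℕ) (y : Mˣ), y ^ p ^ k = z →
      ∃ e : ℤ, e ≤ -1 ∧ v ((y : M) - 1) = (Multiplicative.ofAdd e : Multiplicative ℤ) ∧
        ez ≤ e - k := by
    intro k
    induction k with
    | zero =>
      intro y hy
      have hy0 := hy
      rw [pow_zero, pow_one] at hy
      refine ⟨ez, ?_, by rw [hy]; exact hez, by simp⟩
      have := (hroot1 0 y hy0).2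
      rw [hy, hez, ← WithZero.coe_one, WithZero.coe_lt_coe, ← ofAdd_zero, Multiplicative.ofAdd_lt]
        at this
      omega
    | succ k ih =>
      intro y hy
      -- `y' := y ^ p` satisfies `y' ^ p^k = z`
      have hy' : (y ^ p) ^ p ^ k = z := by rw [← pow_mul, ← pow_succ', hy]
      obtain ⟨e', he'1, hve', hez'⟩ := ih (y ^ p) hy'
      obtain ⟨hvy, hvy1⟩ := hroot1 (k + 1) y hy
      have hy10 : (y : M) - 1 ≠ 0 := by
        intro h
        have : (y : M) = 1 := sub_eq_zero.mp h
        apply hz1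
        rw [← hy, Units.val_pow_eq_pow_val, this, one_pow]
      obtain ⟨e, he⟩ := hexp _ hy10
      have he1 : e ≤ -1 := by
        have := hvy1
        rw [he, ← WithZero.coe_one, WithZero.coe_lt_coe, ← ofAdd_zero, Multiplicative.ofAdd_lt] at this
        omega
      refine ⟨e, he1, he, ?_⟩
      -- `hstep`: `e' ≤ e + max(e_p, e) ≤ e - 1`
      have hst := hstep (y : M) hvy1
      rw [Units.val_pow_eq_pow_val] at hve'
      rw [hve', he] at hst
      -- bound the max by `ofAdd (-1)`
      have hmax : max (v (p : M)) ((Multiplicative.ofAdd e : Multiplicative ℤ) : WithZero (Multiplicative ℤ)) ≤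
          ((Multiplicative.ofAdd (-1 : ℤ) : Multiplicative ℤ) : WithZero (Multiplicative ℤ)) := by
        refine max_le ?_ ?_
        · -- `v p < 1`
          by_cases hp0 : v (p : M) = 0
          · rw [hp0]; exact zero_le
          · obtain ⟨g, hg⟩ := WithZero.ne_zero_iff_exists.mp hp0
            have := hvp
            rw [← hg, ← WithZero.coe_one, WithZero.coe_lt_coe] at this
            rw [← hg, WithZero.coe_le_coe]
            have h' : Multiplicative.toAdd g < 0 := by
              rwa [← Multiplicative.toAdd_lt, toAdd_one] at this
            rw [← ofAdd_toAdd g, Multiplicative.ofAdd_le]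
            omega
        · rw [WithZero.coe_le_coe, Multiplicative.ofAdd_le]; exact he1
      have hle : ((Multiplicative.ofAdd e' : Multiplicative ℤ) : WithZero (Multiplicative ℤ)) ≤
          (Multiplicative.ofAdd e : Multiplicative ℤ) * (Multiplicative.ofAdd (-1 : ℤ) : Multiplicative ℤ) := by
        calc _ ≤ _ := hst
          _ ≤ _ := by gcongr
      rw [← WithZero.coe_mul, WithZero.coe_le_coe, ← ofAdd_add, Multiplicative.ofAdd_le] at hle
      push_cast
      omega
  -- conclude: take `k` large
  obtain ⟨y, hy⟩ := hzdiv (p ^ (ez.natAbs + 1)) (pow_pos hprime.pos _)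
  obtain ⟨e, he1, -, hek⟩ := hiter (ez.natAbs + 1) y hy
  have h3 := le_abs_self ez
  have h4 := neg_le_abs ez
  have h5 : ((ez.natAbs : ℕ) : ℤ) = |ez| := Int.natCast_natAbs ez
  push_cast at hek
  omega

end DVR

end Literature.AnabelianGeometry.AbsoluteAnabelian
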